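import Literature.NumberTheory.LFunctions.RHWave0PNTProofs
import Literature.NumberTheory.Transcendental.ZudilinPhiGrowth
import Mathlib.NumberTheory.Chebyshev
import Mathlib.NumberTheory.Padics.PadicVal.Basic
import HarnessLib

/-!
# Prime windows: `∏_{a n < p ≤ b n} p = e^{(b − a) n + o(n)}` (the prime-number-theorem step of the
# Chudnovsky–Rukhadze–Hata arithmetic scheme)

Topic `Literature/NumberTheory/Irrationality/Hata1992`. HONEST FRAMING (cell `pub-zeta5`): systematic search;
no irrationality claim unless certified. Nothing in this file concerns the arithmetic nature of any constant.

In the "arithmetic method" (Chudnovsky, Rukhadze, Hata, Rhin–Viola, Zudilin, …) the coefficients of a sequence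
of linear forms are shown to be divisible by every prime of certain WINDOWS `p ∈ (n/β, n/α)` (equivalently
`{n/p}` in a fixed interval), and the saving is the integer `Φ_n = ∏ p^{ν_p}` over those primes; its size is
read off "using the well-known prime number theorem":
`lim inf (1/n) Σ_{p ∈ (n/βλ, n/αλ)} log p ≥ (1/λ)(1/α − 1/β)` [cite: Hata1992, §2, proof of (2.5), pp. 340–341]
(there with an extra congruence condition `p ≡ k' (mod b)` and the factor `1/φ(b)`; here `b = 1`), summed over
the windows to give `lim (log Φ_n)/n = ∫ φ dψ − …` [cite: Zudilin2004, Lemma 11 and §8 p. 271].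

This file PROVES the window statement in the form the cell's certificates consume (`le_saving`: `e^{φ n} ≤ Φ_n`
for large `n`), from the prime number theorem `ϑ(x) ∼ x` of the tree
(`Literature.NumberTheory.LFunctions.chebyshevTheta_isEquivalent`):

* `windowPrimes a b n` — the primes `p` with `a·n < p ≤ b·n`; `windowProd a b n = ∏ p` over them (a natural number);
* `log_windowProd_eq_theta_sub` — `log windowProd = ϑ(b n) − ϑ(a n)` (via the tree's
  `Zudilin2004.PhiCert.theta_sub_theta`);
* `tendsto_theta_mul_div` — `ϑ(c n)/n → c` (`c ≥ 0`); `tendsto_log_windowProd_div` — `(log windowProd a b n)/n → b − a`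
  (`0 ≤ a ≤ b`); `eventually_exp_le_windowProd` / `eventually_windowProd_le_exp` — `e^{(b−a−ε)n} ≤ windowProd ≤ e^{(b−a+ε)n}`
  for large `n`;
* `windowProd_pow_dvd`, `windowProd_pow_dvd_int`, `windowProd_pow_dvd_of_le_padicValNat` — if `p^k` divides an
  integer for every prime of the window then so does `windowProd^k` (the primes are distinct);
* `multiWindowProd s a b w n = ∏_i (windowProd (a i) (b i) n)^{w i}` for finitely many weighted windows, with
  `tendsto_log_multiWindowProd_div` (`→ Σ_i w_i (b_i − a_i)`) and `eventually_exp_le_multiWindowProd`.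

`-- TODO(general form):` the `dψ`-integral evaluation `lim (1/n) Σ_{p > √(Cn)} φ(n/p) log p = ∫₀¹ φ dψ` for a
`1`-periodic step function `φ` ([cite: Zudilin2004, Lemma 11]; Hata 1990 Lemma 3.2; Chudnovsky 1983 Thm 4.3) is the
sum of the present statement over the windows `n/p ∈ [k+u, k+v)`, `k = 0, 1, 2, …`, plus a tail estimate; only the
finite-window form is proved here (it is what a finite cell atlas uses).

## References
* [Hata1992] M. Hata, *Irrationality measures of the values of hypergeometric functions*, Acta Arith. 60 (1992)
  335–347, §2 (proof of (2.5), pp. 340–341).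
* [Zudilin2004] W. Zudilin, *Arithmetic of linear forms involving odd zeta values*, J. Théor. Nombres Bordeaux 16
  (2004) 251–291, Lemma 11, §8 (8.8)–(8.9), p. 270–271.
* [Hata1990] M. Hata, *Legendre type polynomials and irrationality measures*, J. reine angew. Math. 407 (1990)
  99–125, Lemma 3.2 (general form; not reproduced here).
-/

noncomputable section

open Finset Filter Real
open scoped Topology

namespace Literature.NumberTheory.Irrationality.Hata1992

/-! ### Windows of primes and their products -/

/-- The primes of the window `(a·n, b·n]`: `p` prime with `⌊a n⌋ < p ≤ ⌊b n⌋`, i.e. (for `a ≥ 0`) `a n < p ≤ b n`.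
[cite: Hata1992, §2 p. 340 (the primes of the interval `J_L = (n/βλ, n/αλ)`)] -/
def windowPrimes (a b : ℝ) (n : ℕ) : Finset ℕ := (Ioc ⌊a * n⌋₊ ⌊b * n⌋₊).filter Nat.Prime

/-- The window factor `∏_{a n < p ≤ b n} p` (a positive integer; the `Φ_n`-type saving contributed by one window
with exponent `1`). [cite: Hata1992, §2 pp. 340–341; Zudilin2004, §8 (8.8)] -/
def windowProd (a b : ℝ) (n : ℕ) : ℕ := ∏ p ∈ windowPrimes a b n, p

variable {a b : ℝ} {n : ℕ}

/-- Members of the window are primes. [cite: Hata1992, §2 p. 340] -/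
theorem prime_of_mem_windowPrimes {p : ℕ} (hp : p ∈ windowPrimes a b n) : p.Prime :=
  (mem_filter.mp hp).2

/-- Membership in the window in real terms (`a ≥ 0`): `p` prime, `a n < p` and `p ≤ b n`.
[cite: Hata1992, §2 p. 340] -/
theorem mem_windowPrimes_iff (ha : 0 ≤ a) {p : ℕ} :
    p ∈ windowPrimes a b n ↔ p.Prime ∧ a * n < p ∧ (p : ℝ) ≤ b * n := by
  unfold windowPrimes
  rw [mem_filter, mem_Ioc]
  have han : 0 ≤ a * n := mul_nonneg ha (Nat.cast_nonneg n)
  constructor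
  · rintro ⟨⟨h1, h2⟩, hp⟩
    refine ⟨hp, (Nat.floor_lt han).mp h1, ?_⟩
    rcases le_or_gt 0 (b * n) with hbn | hbn
    · exact (Nat.le_floor_iff hbn).mp h2
    · exfalso
      have : ⌊b * (n : ℝ)⌋₊ = 0 := Nat.floor_eq_zero.mpr (by linarith)
      rw [this] at h2
      exact absurd (le_antisymm h2 (Nat.zero_le p) ▸ hp) Nat.not_prime_zero
  · rintro ⟨hp, h1, h2⟩
    have hbn : 0 ≤ b * n := le_trans (by exact_mod_cast (Nat.cast_nonneg p : (0 : ℝ) ≤ p)) h2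
    exact ⟨⟨(Nat.floor_lt han).mpr h1, (Nat.le_floor_iff hbn).mpr h2⟩, hp⟩

/-- The window factor is positive. [cite: Hata1992, §2 p. 340] -/
theorem windowProd_pos (a b : ℝ) (n : ℕ) : 0 < windowProd a b n :=
  prod_pos fun _ hp => (prime_of_mem_windowPrimes hp).pos

/-- `log ∏_{window} p = Σ_{window} log p`. [cite: Hata1992, §2 p. 340] -/
theorem log_windowProd_eq_sum (a b : ℝ) (n : ℕ) :
    Real.log (windowProd a b n : ℕ) = ∑ p ∈ windowPrimes a b n, Real.log p := by
  unfold windowProd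
  rw [Nat.cast_prod, Real.log_prod]
  intro p hp
  exact_mod_cast (prime_of_mem_windowPrimes hp).ne_zero

/-- `log ∏_{a n < p ≤ b n} p = ϑ(b n) − ϑ(a n)` (`a ≤ b`). [cite: Hata1992, §2 pp. 340–341] -/
theorem log_windowProd_eq_theta_sub (hab : a ≤ b) (n : ℕ) :
    Real.log (windowProd a b n : ℕ) = Chebyshev.theta (b * n) - Chebyshev.theta (a * n) := by
  -- `ϑ(X) − ϑ(Y) = Σ_{⌊Y⌋ < p ≤ ⌊X⌋} log p` is the tree's `Zudilin2004.PhiCert.theta_sub_theta`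
  rw [log_windowProd_eq_sum, Literature.NumberTheory.Transcendental.Zudilin2004.PhiCert.theta_sub_theta
    (mul_le_mul_of_nonneg_right hab (Nat.cast_nonneg n))]
  rfl

/-! ### The prime number theorem on a window -/

/-- `ϑ(x)/x → 1` (prime number theorem, tree: `chebyshevTheta_isEquivalent`). [cite: Hata1992, §2 p. 340
("using the well-known prime number theorem")] -/
theorem tendsto_theta_div_self : Tendsto (fun x : ℝ => Chebyshev.theta x / x) atTop (𝓝 1) := by
  have hz : ∀ᶠ x : ℝ in atTop, (fun x : ℝ => x) x ≠ 0 := by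
    filter_upwards [eventually_gt_atTop 0] with x hx using hx.ne'
  have h := (Asymptotics.isEquivalent_iff_tendsto_one hz).mp
    Literature.NumberTheory.LFunctions.chebyshevTheta_isEquivalent
  exact h

/-- `ϑ(c n)/n → c` for every real `c ≥ 0`. [cite: Hata1992, §2 pp. 340–341] -/
theorem tendsto_theta_mul_div {c : ℝ} (hc : 0 ≤ c) :
    Tendsto (fun n : ℕ => Chebyshev.theta (c * n) / n) atTop (𝓝 c) := by
  rcases hc.eq_or_lt with rfl | hc'
  · simp [Chebyshev.theta_zero]
  · have hg : Tendsto (fun n : ℕ => c * (n : ℝ)) atTop atTop :=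
      tendsto_natCast_atTop_atTop.const_mul_atTop hc'
    have h1 := (tendsto_theta_div_self.comp hg).const_mul c
    rw [mul_one] at h1
    refine h1.congr' ?_
    filter_upwards [eventually_ge_atTop 1] with n hn
    have hn' : (n : ℝ) ≠ 0 := by positivity
    simp only [Function.comp_def]
    field_simp

/-- **The window asymptotic**: `(1/n) log ∏_{a n < p ≤ b n} p → b − a` (`0 ≤ a ≤ b`), i.e.
`Σ_{a n < p ≤ b n} log p = (b − a) n + o(n)`. [cite: Hata1992, §2, proof of (2.5), pp. 340–341] -/
theorem tendsto_log_windowProd_div (ha : 0 ≤ a) (hab : a ≤ b) :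
    Tendsto (fun n : ℕ => Real.log (windowProd a b n : ℕ) / n) atTop (𝓝 (b - a)) := by
  have h := (tendsto_theta_mul_div (ha.trans hab)).sub (tendsto_theta_mul_div ha)
  refine h.congr' (Eventually.of_forall fun n => ?_)
  beta_reduce
  rw [log_windowProd_eq_theta_sub hab n, sub_div]

/-- Lower exponential bound: for every `ε > 0`, `e^{(b − a − ε) n} ≤ ∏_{a n < p ≤ b n} p` for all large `n` — the
`le_saving` input of a linear-form certificate. [cite: Hata1992, §2, proof of (2.5), pp. 340–341] -/
theorem eventually_exp_le_windowProd (ha : 0 ≤ a) (hab : a ≤ b) {ε : ℝ} (hε : 0 < ε) :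
    ∀ᶠ n : ℕ in atTop, Real.exp ((b - a - ε) * n) ≤ (windowProd a b n : ℕ) := by
  have h2 : ∀ᶠ n : ℕ in atTop, b - a - ε < Real.log (windowProd a b n : ℕ) / n :=
    (tendsto_log_windowProd_div ha hab).eventually (eventually_gt_nhds (by linarith))
  filter_upwards [h2, eventually_gt_atTop 0] with n hn hn0
  have hn' : (0 : ℝ) < n := by exact_mod_cast hn0
  have hpos : (0 : ℝ) < (windowProd a b n : ℕ) := by exact_mod_cast windowProd_pos a b n
  rw [lt_div_iff₀ hn'] at hn
  calc Real.exp ((b - a - ε) * n) ≤ Real.exp (Real.log (windowProd a b n : ℕ)) :=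
        Real.exp_le_exp.mpr hn.le
    _ = (windowProd a b n : ℕ) := Real.exp_log hpos

/-- Upper exponential bound: for every `ε > 0`, `∏_{a n < p ≤ b n} p ≤ e^{(b − a + ε) n}` for all large `n`.
[cite: Hata1992, §2 p. 341 ("the desired upper estimate … by a similar argument")] -/
theorem eventually_windowProd_le_exp (ha : 0 ≤ a) (hab : a ≤ b) {ε : ℝ} (hε : 0 < ε) :
    ∀ᶠ n : ℕ in atTop, ((windowProd a b n : ℕ) : ℝ) ≤ Real.exp ((b - a + ε) * n) := by
  have h2 : ∀ᶠ n : ℕ in atTop, Real.log (windowProd a b n : ℕ) / n < b - a + ε :=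
    (tendsto_log_windowProd_div ha hab).eventually (eventually_lt_nhds (by linarith))
  filter_upwards [h2, eventually_gt_atTop 0] with n hn hn0
  have hn' : (0 : ℝ) < n := by exact_mod_cast hn0
  have hpos : (0 : ℝ) < (windowProd a b n : ℕ) := by exact_mod_cast windowProd_pos a b n
  rw [div_lt_iff₀ hn'] at hn
  calc ((windowProd a b n : ℕ) : ℝ) = Real.exp (Real.log (windowProd a b n : ℕ)) := (Real.exp_log hpos).symm
    _ ≤ Real.exp ((b - a + ε) * n) := Real.exp_le_exp.mpr hn.le

/-! ### Divisibility: window-wise `p`-adic bounds give the window factor -/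

/-- If `p^k ∣ m` for every prime `p` of the window, then `(∏_{window} p)^k ∣ m` (the primes are distinct, hence
pairwise coprime). [cite: Hata1992, §2 p. 340 ("each prime number `p ∈ S_n` divides all the integers (2.3)");
Zudilin2004, §8 (8.8)–(8.9)] -/
theorem windowProd_pow_dvd {k m : ℕ} (h : ∀ p ∈ windowPrimes a b n, p ^ k ∣ m) :
    windowProd a b n ^ k ∣ m := by
  unfold windowProd
  rw [← prod_pow]
  have key : ∀ s : Finset ℕ, s ⊆ windowPrimes a b n → (∏ p ∈ s, p ^ k) ∣ m := by
    intro s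
    induction s using Finset.induction_on with
    | empty => intro _; simp
    | insert q s hq ih =>
      intro hs
      rw [prod_insert hq]
      have hqW : q ∈ windowPrimes a b n := hs (mem_insert_self q s)
      have hsW : s ⊆ windowPrimes a b n := fun x hx => hs (mem_insert_of_mem hx)
      refine Nat.Coprime.mul_dvd_of_dvd_of_dvd ?_ (h q hqW) (ih hsW)
      refine Nat.Coprime.prod_right fun r hr => ?_
      refine Nat.Coprime.pow _ _ ((Nat.coprime_primes (prime_of_mem_windowPrimes hqW)
        (prime_of_mem_windowPrimes (hsW hr))).mpr ?_)
      rintro rfl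
      exact hq hr
  exact key _ subset_rfl

/-- Integer version: if `(p : ℤ)^k ∣ z` for every prime `p` of the window, then `(windowProd)^k ∣ z`.
[cite: Hata1992, §2 p. 340; Zudilin2004, §8 (8.8)–(8.9)] -/
theorem windowProd_pow_dvd_int {k : ℕ} {z : ℤ} (h : ∀ p ∈ windowPrimes a b n, (p : ℤ) ^ k ∣ z) :
    ((windowProd a b n ^ k : ℕ) : ℤ) ∣ z := by
  rw [Int.natCast_dvd]
  refine windowProd_pow_dvd fun p hp => ?_
  have := h p hp
  rw [← Int.natCast_pow, Int.natCast_dvd] at this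
  exact this

/-- `p`-adic phrasing: if `m ≠ 0` and `k ≤ v_p(m)` for every prime `p` of the window, then `(windowProd)^k ∣ m`.
[cite: Zudilin2004, §8 (8.8)–(8.9) (`Φ_n = ∏ p^{ν_p}` with `ν_p ≤ ord_p` of the coefficients)] -/
theorem windowProd_pow_dvd_of_le_padicValNat {k m : ℕ} (hm : m ≠ 0)
    (h : ∀ p ∈ windowPrimes a b n, k ≤ padicValNat p m) : windowProd a b n ^ k ∣ m := by
  refine windowProd_pow_dvd fun p hp => ?_
  haveI : Fact p.Prime := ⟨prime_of_mem_windowPrimes hp⟩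
  exact (padicValNat_dvd_iff_le hm).mpr (h p hp)

/-! ### Finitely many weighted windows -/

/-- The saving factor of a finite atlas of windows with integer weights:
`Φ_n = ∏_{i ∈ s} (∏_{a_i n < p ≤ b_i n} p)^{w_i}`. [cite: Zudilin2004, §8 (8.8) (the shape `∏ p^{ν_p}` with
`ν_p` constant on each window); Hata1992, §2 pp. 340–341] -/
def multiWindowProd {ι : Type*} (s : Finset ι) (a b : ι → ℝ) (w : ι → ℕ) (n : ℕ) : ℕ :=
  ∏ i ∈ s, windowProd (a i) (b i) n ^ w i

variable {ι : Type*} {s : Finset ι} {A B : ι → ℝ} {w : ι → ℕ}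

/-- The atlas factor is positive. [cite: Zudilin2004, §8 (8.8)] -/
theorem multiWindowProd_pos (s : Finset ι) (A B : ι → ℝ) (w : ι → ℕ) (n : ℕ) :
    0 < multiWindowProd s A B w n :=
  prod_pos fun i _ => pow_pos (windowProd_pos (A i) (B i) n) _

/-- `log Φ_n = Σ_i w_i log ∏_{window i} p`. [cite: Zudilin2004, §8 p. 271] -/
theorem log_multiWindowProd (s : Finset ι) (A B : ι → ℝ) (w : ι → ℕ) (n : ℕ) :
    Real.log (multiWindowProd s A B w n : ℕ) = ∑ i ∈ s, (w i : ℝ) * Real.log (windowProd (A i) (B i) n : ℕ) := by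
  unfold multiWindowProd
  rw [Nat.cast_prod, Real.log_prod]
  · refine sum_congr rfl fun i _ => ?_
    rw [Nat.cast_pow, Real.log_pow]
  · intro i _
    exact_mod_cast (pow_pos (windowProd_pos (A i) (B i) n) _).ne'

/-- **Atlas asymptotic**: `(1/n) log Φ_n → Σ_i w_i (b_i − a_i)` when `0 ≤ a_i ≤ b_i` for all `i`.
[cite: Zudilin2004, Lemma 11 (finite-window part); Hata1992, §2 pp. 340–341] -/
theorem tendsto_log_multiWindowProd_div (h : ∀ i ∈ s, 0 ≤ A i ∧ A i ≤ B i) :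
    Tendsto (fun n : ℕ => Real.log (multiWindowProd s A B w n : ℕ) / n) atTop
      (𝓝 (∑ i ∈ s, (w i : ℝ) * (B i - A i))) := by
  have hi : ∀ i ∈ s, Tendsto (fun n : ℕ => (w i : ℝ) * (Real.log (windowProd (A i) (B i) n : ℕ) / n)) atTop
      (𝓝 ((w i : ℝ) * (B i - A i))) :=
    fun i hi => (tendsto_log_windowProd_div (h i hi).1 (h i hi).2).const_mul _
  refine (tendsto_finsetSum s hi).congr' (Eventually.of_forall fun n => ?_)
  beta_reduce
  rw [log_multiWindowProd, sum_div]
  refine sum_congr rfl fun i _ => ?_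
  ring

/-- **`le_saving` for an atlas**: for every `ε > 0`, `e^{(Σ_i w_i (b_i − a_i) − ε) n} ≤ Φ_n` for all large `n`.
[cite: Zudilin2004, Lemma 11 (finite-window part); Hata1992, §2 pp. 340–341] -/
theorem eventually_exp_le_multiWindowProd (h : ∀ i ∈ s, 0 ≤ A i ∧ A i ≤ B i) {ε : ℝ} (hε : 0 < ε) :
    ∀ᶠ n : ℕ in atTop,
      Real.exp ((∑ i ∈ s, (w i : ℝ) * (B i - A i) - ε) * n) ≤ (multiWindowProd s A B w n : ℕ) := by
  have h2 : ∀ᶠ n : ℕ in atTop,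
      ∑ i ∈ s, (w i : ℝ) * (B i - A i) - ε < Real.log (multiWindowProd s A B w n : ℕ) / n :=
    (tendsto_log_multiWindowProd_div h).eventually (eventually_gt_nhds (by linarith))
  filter_upwards [h2, eventually_gt_atTop 0] with n hn hn0
  have hn' : (0 : ℝ) < n := by exact_mod_cast hn0
  have hpos : (0 : ℝ) < (multiWindowProd s A B w n : ℕ) := by exact_mod_cast multiWindowProd_pos s A B w n
  rw [lt_div_iff₀ hn'] at hn
  calc Real.exp ((∑ i ∈ s, (w i : ℝ) * (B i - A i) - ε) * n)
        ≤ Real.exp (Real.log (multiWindowProd s A B w n : ℕ)) := Real.exp_le_exp.mpr hn.le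
    _ = (multiWindowProd s A B w n : ℕ) := Real.exp_log hpos

/-- Upper bound for an atlas: `Φ_n ≤ e^{(Σ_i w_i (b_i − a_i) + ε) n}` for all large `n`.
[cite: Zudilin2004, Lemma 11 (finite-window part); Hata1992, §2 p. 341] -/
theorem eventually_multiWindowProd_le_exp (h : ∀ i ∈ s, 0 ≤ A i ∧ A i ≤ B i) {ε : ℝ} (hε : 0 < ε) :
    ∀ᶠ n : ℕ in atTop,
      ((multiWindowProd s A B w n : ℕ) : ℝ) ≤ Real.exp ((∑ i ∈ s, (w i : ℝ) * (B i - A i) + ε) * n) := by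
  have h2 : ∀ᶠ n : ℕ in atTop,
      Real.log (multiWindowProd s A B w n : ℕ) / n < ∑ i ∈ s, (w i : ℝ) * (B i - A i) + ε :=
    (tendsto_log_multiWindowProd_div h).eventually (eventually_lt_nhds (by linarith))
  filter_upwards [h2, eventually_gt_atTop 0] with n hn hn0
  have hn' : (0 : ℝ) < n := by exact_mod_cast hn0
  have hpos : (0 : ℝ) < (multiWindowProd s A B w n : ℕ) := by exact_mod_cast multiWindowProd_pos s A B w n
  rw [div_lt_iff₀ hn'] at hn
  calc ((multiWindowProd s A B w n : ℕ) : ℝ) = Real.exp (Real.log (multiWindowProd s A B w n : ℕ)) :=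
        (Real.exp_log hpos).symm
    _ ≤ Real.exp ((∑ i ∈ s, (w i : ℝ) * (B i - A i) + ε) * n) := Real.exp_le_exp.mpr hn.le

/-- The atlas factor divides an integer as soon as each window prime power does.
[cite: Zudilin2004, §8 (8.8)–(8.9); Hata1992, §2 p. 340] -/
theorem multiWindowProd_dvd_int [DecidableEq ι] {z : ℤ}
    (h : ∀ i ∈ s, ∀ p ∈ windowPrimes (A i) (B i) n, (p : ℤ) ^ w i ∣ z)
    (hdisj : ∀ i ∈ s, ∀ j ∈ s, i ≠ j → Disjoint (windowPrimes (A i) (B i) n) (windowPrimes (A j) (B j) n)) :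
    ((multiWindowProd s A B w n : ℕ) : ℤ) ∣ z := by
  rw [Int.natCast_dvd]
  unfold multiWindowProd
  have hnat : ∀ i ∈ s, windowProd (A i) (B i) n ^ w i ∣ z.natAbs := fun i hi => by
    have := windowProd_pow_dvd_int (h i hi)
    rwa [Int.natCast_dvd] at this
  -- pairwise coprime factors
  have key : ∀ t : Finset ι, t ⊆ s → (∏ i ∈ t, windowProd (A i) (B i) n ^ w i) ∣ z.natAbs := by
    intro t
    induction t using Finset.induction_on with
    | empty => intro _; simp
    | insert j t hj ih =>
      intro ht
      rw [prod_insert hj]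
      have hjs : j ∈ s := ht (mem_insert_self j t)
      have hts : t ⊆ s := fun x hx => ht (mem_insert_of_mem hx)
      refine Nat.Coprime.mul_dvd_of_dvd_of_dvd ?_ (hnat j hjs) (ih hts)
      refine Nat.Coprime.prod_right fun i hi => Nat.Coprime.pow _ _ ?_
      -- windowProd over disjoint prime sets are coprime
      have hij : j ≠ i := by rintro rfl; exact hj hi
      have hd := hdisj j hjs i (hts hi) hij
      unfold windowProd
      refine Nat.Coprime.prod_left fun p hp => Nat.Coprime.prod_right fun q hq => ?_
      refine (Nat.coprime_primes (prime_of_mem_windowPrimes hp) (prime_of_mem_windowPrimes hq)).mpr ?_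
      rintro rfl
      exact disjoint_left.mp hd hp hq
  exact key s subset_rfl

end Literature.NumberTheory.Irrationality.Hata1992
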